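import Summits.QuantumFields.QCD.Theses.NestedDissectionSea
import Summits.QuantumFields.QCD.Theorems.EarlyCrosserLaw.Negative.CellPositivityDomain
import Literature.MathematicalPhysics.QuantumLattice.TopologicalCriticalMass
import HarnessLib.Audit

/-!
# Line `cells-inherit-torus-extinction` for crux `NestedDissectionSea.EarlyCrosserLaw`
# (stmt-QuantumFields-13995, rank 2 of route-QuantumFields-NestedDissectionSea) — crux-plan skeleton, gen 2

Skeleton of the crux idea `Ideas/cells-inherit-torus-extinction.md` (ideator 3, round 1; triage r1-1 /
r1-2 / r1-3: pass, pass, pass, with sharpenings — all acted on). Line card: `Lines/cells-inherit-torus-extinction.md`.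
Planner seats: gen 1 `planner-cruxplan-stmt-QuantumFields-13995-cells-inherit-torus--0` (architecture S1–S4 and
the composition), gen 2 `…-cells-inherit-torus--g2-0` (this file).

**Gen-2 delta (mechanical, for the lead and the stub workers).** Same four stubs, same mathematics, same
composition; but every `stub_*` signature is now stated over TREE VOCABULARY ONLY (`QCDRegularisation`,
`fermionDet`, `wilsonDirac`, `fundamentalRep`, `wilsonMeasureFamily`, `SU3`, `GaugeConfig`, `TorusSite`,
`wilsonBox`, `wilsonCell` + Mathlib) with NO local definition, NO `let` and NO named argument inside a
signature — so that (i) the registered stub record (`ledger skeleton check`, which cuts a signature at its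
first `:=`) is the COMPLETE statement, (ii) a stub worker's file under `Theorems/` can state the registered
signature literally with `import Summits.QuantumFields.QCD.Theses.NestedDissectionSea` +
`import Literature.MathematicalPhysics.QuantumLattice.TopologicalCriticalMass` and the `open`s of this
file, in this namespace, and (iii) the final crux file is definition-free. The gen-1 local vocabulary is
inlined as follows: `zeroExt x t w ↦ fun q => if h : wilsonBox x t q then w ⟨q, h⟩ else 0`;
`faceMass x t w ↦ ∑ q, if (∃ i, (q.1.1 i - x i).val = 1 ∨ (q.1.1 i - x i).val + 1 = t i) then ‖w q‖² else 0`;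
`Majorised μ wt A δ ↦ ∃ g ≥ 0, (A → 1 ≤ g) ∧ Integrable (g·wt) μ ∧ ∫ g wt ∂μ / ∫ wt ∂μ ≤ δ`;
`TwoSidedPin` ↦ the crux's clauses (b) ∧ (b″) written out (their `let`s zeta-expanded, the measure
`wilsonMeasure (d := 4) (L := 2S+1) (fundamentalRep (Fin 3)) (reg.β k)` spelled by the tree abbreviation
`wilsonMeasureFamily (reg.β k) S`, the colour group by the tree abbreviation `SU3`) — definitionally the
crux's own clauses (the composition discharges them by `exact`).

## The crux (route file rev 23, verbatim)

`∀ N_f ∈ {2,3} ∃ reg (HasMassScaling, HasAsymptoticScaling) ∃ M₀ ≥ 0 ∃ b₀ ≥ 2 ∃ ℓ > 0 ∀ m > M₀ ∃ R > 0:`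
(a′) window dilution of EARLY CROSSERS: for every `ε > 0`, eventually in `k`, on every odd torus of
physical side `≥ R`, `∃ δ ≥ 0`, `Σ_{j<J} δ_j ≤ ε`, such that for every corner-0 window box at scale `j`
and every event `E` implying "for some flavour `f` and some bare mass `μ' ≥ m_f(k)` the box OR ONE OF
ITS 16 CHILDREN has `det wilsonCell = 0`", the phase-quenched probability `P(E) ≤ δ_j`; (b) the LOWER
parity pin; (b″) the UPPER parity pin (the two-sided intrinsic pin of `m_crit`).

## The line in one paragraph

An early crosser is a kernel vector `w` of a Dirichlet cell `D_c(U, μ')` (the window box or a child) at a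
bare mass `μ' ≥ m_f(k)`. Split by FACE MASS (the `ℓ²` mass of `w` on the layers adjacent to the bounding
sheets) at the threshold `θ_f = (c·a_k m_f/(8 Z_m))²`:
* FACE-LIGHT (the interior population; at the entropy-carrying top scales all but a boundary layer of
  thickness `≍ ρ_* log(1/a_k) ≪ s_j`): the zero-extension `ŵ` agrees with `D_c w = 0` inside the box and
  leaks only into the one-site collar, `‖D_W(U,μ') ŵ‖² ≤ 64·faceMass(w)` (S1 `stub_zeroExtensionQuasimode`,
  deterministic), so `ŵ` is a BOX-SUPPORTED QUASIMODE OF THE TORUS OPERATOR at level `c·a_k m_f/Z_m` —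
  equivalently (`Γ₅` unitary) of the HERMITIAN Wilson operator `Γ₅ D_W(U,μ',1)`, a local pseudospectral
  event. Their window-rarity is S2 `stub_torusLocalExtinction`: the TORUS content of (a′), stated (as all
  three triagers demanded) not as the sibling decl `SpectralDefectExtinction.WindowExtinction` by name but as
  its Hermitian local body AT THIS CRUX'S PINNED LINE.
* FACE-HEAVY (the sheet-attached population — the only CELL-SPECIFIC early crossers): near-sheet lumps
  (Dirichlet cutting raises `⟨W_U⟩`, so they cross LATER than on the torus) and Kaplan/Shamir wall states,
  which by the universal face commutator `[W_c, N_c] = ½Σ_μ Γ_μ(E^μ_first − E^μ_last) + plaquette terms`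
  need a γ_μ-polarised face layer backed by a locally SUPERCRITICAL (cold) collar, a large deviation above
  the pinned line. Their window-rarity is S3 `stub_sheetAttachedRarity` (`s³ ×` boundary-layer entropy).
The PIN (b) ∧ (b″) is untouched by the idea and carried as the named stub S4 `stub_twoSidedParityPin`
(panel note P1; RobustYangMills class, shared); S2 and S3 are stated FOR EVERY admissible regularisation
obeying the two-sided pin, which is how the four stubs share ONE `reg` without any stub restating the crux
(`trivial_without_lowerPin`: the junk reg `m_crit ≡ 1` fails the pin, so nothing is bought vacuously).

## Composition (`EarlyCrosserLaw_of`, sorry-free apart from the four stubs it cites by name)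

`reg, M₀, pin` from S4; `c` from S2 at `(reg, M₀)`; `b₀ := 2`, `ℓ := 1` (S2, S3 hold for every `b₀ ≥ 2`,
`ℓ > 0`; the lead may change the two literals); for `m > M₀` the pin's `R`; (b), (b″) by `exact`; (a′): S2
and S3 at `(b₀, ℓ, m, R, ε/34)`, `δ_j := 17(δ²_j + δ³_j)`; each of the 17 boxes (parent + 16 children,
`halfSides ≤ s`) contributes two majorised events; the face dichotomy + S1 (`64·(x/8)² = x²`) puts every
crux witness into one of the 34 events; `outer_union_bound` (integrable majorants ⇒ union bound WITHOUT
measurability of the crux's arbitrary `E`; junk-safe, `x/0 = 0`) closes.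

## Disproof.lean (cdisprove-13995-0, v5 + 02:07Z touch-up; NO KILL, no `-- Targets` stub kills) — honoured

* `trivial_without_lowerPin` (§2): the line uses H = (b) at `stub_twoSidedParityPin` and threads the
  two-sided pin into S2/S3 as their hypothesis; the junk witness `junkReg` fails it.
* `lowerPin_forces_mcrit_le` / `lowerPin_forces_pinnedMass_ge` (§3, §3b): at every pinned reg the
  thresholds `m_f(k)` of S2/S3 lie in the Wilson band; the positivity domain (§1, landed
  `det_toSquareBlockProp_wilsonDirac_ne_zero`, `wilsonCell_det_ne_zero_of_pos`) empties both events for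
  `μ' > c·a m_f/Z_m`; S1 is §1's quantitative companion (same zero-extension device).
* `wilsonCell_two_det_eq_zero_iff` / `det_wilsonCell_two` (§4, LANDED p74201, imported here): the one-site
  child is singular only at `μ' = -4`; it would make S3's event certain iff `m_f(k) ≤ -4`, excluded at every
  two-sided-pinned reg near the physical line; no stub is an instance of the landed lemma's negation.
* §5 accounting: S2's sharp open point is `κ₀(SU(3)) ≥ 4/b`; S3 isolates §5's "Dirichlet-BOUNDARY-induced
  real eigenvalues of the cells" as a statement.
Negatives index (`ledger negatives --problem QuantumFields`: 9665, 9603, 9494, 9599): untouched.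
-/

noncomputable section

open Matrix Complex Filter MeasureTheory
open Literature.MathematicalPhysics.QuantumLattice Literature.MathematicalPhysics.QuantumFieldTheory
  Literature.Probability.LatticeModels
open Summit.QuantumFields.QCD.Theses.NestedDissectionSea

namespace Summit.QuantumFields.QCD.Cruxes.EarlyCrosserLaw.CellsInheritTorusExtinction

open scoped ComplexConjugate BigOperators

/-! ## §1 Registered stubs (`sorry` lives only here; every signature is tree-vocabulary only) -/

/-- **S1 — zero-extension transfer (deterministic; provable now; size M).** For every torus side `N`, SU(3)
field `U`, bare mass `μ`, box `(x, t)` with `t_i ≤ N` and every KERNEL VECTOR `w` of the Dirichlet cell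
`wilsonCell U μ x t`, the zero-extension `ŵ = fun q => if q ∈ box then w q else 0` satisfies
`Σ_p ‖(D_W(U,μ,1) ŵ)(p)‖² ≤ 64 · faceMass(w)`, where `faceMass(w)` is the `ℓ²` mass of `w` on the first /
last interior layer in some direction (offset `1` or `t_i - 1` from the corner). Proof sketch: inside the
box `(D_W ŵ)(p) = (D_c w)(p) = 0` (`toSquareBlockProp` restricts both indices); outside,
`(D_W ŵ)(p) = -½Σ_μ[((1-γ_μ)⊗U)ŵ(p+μ̂) + ((1+γ_μ)⊗U⁻¹)ŵ(p-μ̂)]`, `‖1∓γ_μ‖ = 2`, `U` unitary, so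
`‖(D_W ŵ)(p)‖ ≤ Σ_{≤ 8 nbrs} ‖ŵ(q)‖`; Cauchy–Schwarz; every inside site with an outside neighbour lies on a
first/last layer and neighbours `≤ 8` outside sites (`8 × 8 = 64`; the true constant is `≈ 2`). The
hypothesis `t_i ≤ N` excludes wrap-around (else the last interior layer is not flagged). Consequence: a
face-light crosser is a box-supported quasimode of the torus operator and, `Γ₅` being unitary, of the
HERMITIAN `Γ₅ D_W(U,μ,1)`. Leans on: `wilsonCell`, `wilsonBox`, `wilsonDirac`, `Matrix.toSquareBlockProp`,
landed `det_toSquareBlockProp_wilsonDirac_ne_zero` (same device). -/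
theorem stub_zeroExtensionQuasimode :
    ∀ (N : ℕ) [NeZero N] (U : GaugeConfig 4 N SU3) (μ : ℝ) (x : TorusSite 4 N) (t : Fin 4 → ℕ)
      (w : {p // wilsonBox x t p} → ℂ), (∀ i, t i ≤ N) → wilsonCell U μ x t *ᵥ w = 0 →
      ∑ p, ‖(wilsonDirac (fundamentalRep (Fin 3)) U μ 1 *ᵥ
          fun q => if h : wilsonBox x t q then w ⟨q, h⟩ else 0) p‖ ^ 2 ≤
        64 * ∑ q : {p // wilsonBox x t p},
          (if (∃ i, (q.1.1 i - x i).val = 1 ∨ (q.1.1 i - x i).val + 1 = t i) then ‖w q‖ ^ 2 else 0) := by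
  sorry

/-- **S2 — torus-local (Hermitian) extinction of early quasimodes at the pinned line (open; hardest; the
TORUS content of (a′), `WindowExtinction`-class, restated at THIS crux's reg as triage r1-1/r1-2/r1-3
demanded).** For `N_f ∈ {2,3}`, EVERY admissible `reg` and `M₀ ≥ 0` obeying the two-sided pin (the
hypothesis is the crux's clauses (b) ∧ (b″) with their `∀ m ∃ R`): there is a level `c > 0` such that for
all `b₀ ≥ 2`, `ℓ > 0`, mass tuples `m > M₀`, `R > 0`, `ε > 0`, eventually in `k`, on every odd torus
`2S+1` of physical side `≥ R`: `∃ δ ≥ 0`, `Σ_{j<J} δ_j ≤ ε` (`J = ⌊log₂(⌊ℓ/a_k⌋/b₀)⌋ + 1`), and for every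
box `(x, t)` of ANY corner with `t_i < b₀2^{j+2}`, `t_i ≤ 2S+1`, `t_i a_k ≤ ℓ` the event "for some
flavour `f`, some `μ' ≥ m_f(k)` and some `v ≠ 0` supported in the box, `‖D_W(U,μ',1) v̂‖² ≤
(c a_k m_f/Z_m)² ‖v‖²`" is MAJORISED at level `δ_j`: there is `g ≥ 0`, `g ≥ 1` on the event, with `g · wt`
integrable and `∫ g wt / ∫ wt ≤ δ_j` under the Wilson measure at `β_k`, `wt = ∏_f |det D_W(m_f(k))|`
(integrable majorants make window laws ADD over populations and boxes with no measurability of the crux's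
arbitrary events). Why plausibly true: `‖D_W v̂‖ = ‖Γ₅D_W v̂‖` and above the line the Hermitian Wilson
operator at the valence mass has a spectral gap `≍ Z·a m/Z_m` whose downward fluctuations are rare and
shrink with `a` (Del Debbio–Giusti–Lüscher–Petronzio–Tantalo hep-lat/0512021; Mohler–Schaefer 2020:
`⟨n_neg⟩ ∝ a^{6.8}` at fixed volume); a box-supported quasimode has covariant kinetic energy
`⟨W_U⟩ ≤ |m_f(k)| + c h → 0` (numerical range, landed `re_quadForm_wilsonDirac_ge`), so only covariantly
smooth carriers of size `≥ s_free ≍ 2.75 β^{1/2}` qualify (route `KineticEdge`), and those are the route's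
chiral lumps, counted by the UV-CONVERGENT end of the instanton measure (`b = 11 - 2N_f/3 > 4`; Disproof
§5, route L4–L5); Wegner / Lifshitz-tail local-DOS technology applies to THIS Hermitian object (sibling
`WegnerEstimate`), not to non-normal cell eigenvalues. Why it might fail: Disproof §5.5's sharp target
`κ₀(SU(3)) ≥ 4/b` (a `Q = 0` connection with an accidental zero-mode pair and action `< (4-b')/b` of an
instanton would proliferate per physical volume); pseudospectral events are MORE frequent than exact
crossings (non-normal outliers of `B_U` below its typical edge, Disproof §5.1); `c < 1` is essential
(`c ≥ 1` reaches the line itself, where index modes cross). Size: open (route tier). Leans on: `wilsonDirac`,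
`wilsonMeasureFamily`, `fermionDet`, `QCDRegularisation`, `wilsonMeasure_map_torusConfigShift` (corner
`x ↦ 0`), `isHermitian_hermitianWilsonDirac`; sources MohlerSchaefer2020, DebbioEtAl2006 (hep-lat/0512021),
Wegner1981DensityOfStates, EdwardsHellerNarayanan1998, GoltermanShamir2003. -/
theorem stub_torusLocalExtinction :
    ∀ Nf : ℕ, (Nf = 2 ∨ Nf = 3) → ∀ reg : QCDRegularisation Nf, reg.HasMassScaling →
      (reg.scheme 0 0 0).HasAsymptoticScaling → ∀ M₀ : ℝ, 0 ≤ M₀ →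
      (∀ m : Fin Nf → ℝ, (∀ f, M₀ < m f) → ∃ R : ℝ, 0 < R ∧
        (∀ M : ℝ, M₀ < M → ∀ᶠ k : ℕ in Filter.atTop, ∀ S : ℕ, R ≤ reg.a k * (2 * S + 1) →
          (1 / 4 : ℝ) ≤
            (∫ U, (if (fermionDet (wilsonDirac (fundamentalRep (Fin 3)) U
                  (reg.mcrit k - reg.a k * M / reg.Zm k) 1)).re < 0 then (1 : ℝ) else 0) *
                (∏ f, ‖fermionDet (wilsonDirac (fundamentalRep (Fin 3)) U
                  (reg.mcrit k + reg.a k * m f / reg.Zm k) 1)‖) ∂(wilsonMeasureFamily (reg.β k) S)) /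
            (∫ U, (∏ f, ‖fermionDet (wilsonDirac (fundamentalRep (Fin 3)) U
                  (reg.mcrit k + reg.a k * m f / reg.Zm k) 1)‖) ∂(wilsonMeasureFamily (reg.β k) S))) ∧
        (∀ M : ℝ, M₀ < M → ∀ᶠ k : ℕ in Filter.atTop, ∀ S : ℕ, R ≤ reg.a k * (2 * S + 1) →
          reg.a k * (2 * S + 1) ≤ 2 * R →
            (∫ U, (if (fermionDet (wilsonDirac (fundamentalRep (Fin 3)) U
                  (reg.mcrit k + reg.a k * M / reg.Zm k) 1)).re < 0 then (1 : ℝ) else 0) *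
                (∏ f, ‖fermionDet (wilsonDirac (fundamentalRep (Fin 3)) U
                  (reg.mcrit k + reg.a k * m f / reg.Zm k) 1)‖) ∂(wilsonMeasureFamily (reg.β k) S)) /
            (∫ U, (∏ f, ‖fermionDet (wilsonDirac (fundamentalRep (Fin 3)) U
                  (reg.mcrit k + reg.a k * m f / reg.Zm k) 1)‖) ∂(wilsonMeasureFamily (reg.β k) S))
              ≤ (1 / 8 : ℝ))) →
      ∃ c : ℝ, 0 < c ∧ ∀ b₀ : ℕ, 2 ≤ b₀ → ∀ ℓ : ℝ, 0 < ℓ → ∀ m : Fin Nf → ℝ, (∀ f, M₀ < m f) →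
        ∀ R : ℝ, 0 < R → ∀ ε : ℝ, 0 < ε → ∀ᶠ k : ℕ in Filter.atTop, ∀ S : ℕ,
          R ≤ reg.a k * (2 * S + 1) →
          ∃ δ : ℕ → ℝ, (∀ j, 0 ≤ δ j) ∧
            ∑ j ∈ Finset.range (Nat.log 2 (⌊ℓ / reg.a k⌋₊ / b₀) + 1), δ j ≤ ε ∧
            ∀ j < Nat.log 2 (⌊ℓ / reg.a k⌋₊ / b₀) + 1,
              ∀ (x : TorusSite 4 (2 * S + 1)) (t : Fin 4 → ℕ),
                (∀ i, t i < b₀ * 2 ^ (j + 2) ∧ t i ≤ 2 * S + 1 ∧ (t i : ℝ) * reg.a k ≤ ℓ) →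
                ∃ g : GaugeConfig 4 (2 * S + 1) SU3 → ℝ, (∀ U, 0 ≤ g U) ∧
                  (∀ U, (∃ f : Fin Nf, ∃ μ' : ℝ, reg.mcrit k + reg.a k * m f / reg.Zm k ≤ μ' ∧
                      ∃ v : {p // wilsonBox x t p} → ℂ, v ≠ 0 ∧
                        ∑ p, ‖(wilsonDirac (fundamentalRep (Fin 3)) U μ' 1 *ᵥ
                            fun q => if h : wilsonBox x t q then v ⟨q, h⟩ else 0) p‖ ^ 2 ≤
                          (c * (reg.a k * m f / reg.Zm k)) ^ 2 * ∑ q, ‖v q‖ ^ 2) → 1 ≤ g U) ∧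
                  MeasureTheory.Integrable (fun U => g U *
                    (∏ f, ‖fermionDet (wilsonDirac (fundamentalRep (Fin 3)) U
                      (reg.mcrit k + reg.a k * m f / reg.Zm k) 1)‖)) (wilsonMeasureFamily (reg.β k) S) ∧
                  (∫ U, g U * (∏ f, ‖fermionDet (wilsonDirac (fundamentalRep (Fin 3)) U
                      (reg.mcrit k + reg.a k * m f / reg.Zm k) 1)‖) ∂(wilsonMeasureFamily (reg.β k) S)) /
                    (∫ U, (∏ f, ‖fermionDet (wilsonDirac (fundamentalRep (Fin 3)) U
                      (reg.mcrit k + reg.a k * m f / reg.Zm k) 1)‖) ∂(wilsonMeasureFamily (reg.β k) S))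
                    ≤ δ j := by
  sorry

/-- **S3 — sheet-attached early crossers are window-rare at the pinned line (open; THE cell-specific content
of (a′): what Dirichlet sheets add to the torus statement; the line's own lever).** Same hypotheses as S2,
but for EVERY level `c > 0`: the event "for some `f`, some `μ' ≥ m_f(k)`, the Dirichlet cell of the box
`(x, t)` has a kernel vector `w ≠ 0` whose face mass exceeds `(c a_k m_f/(8 Z_m))² ‖w‖²`" is majorised at
level `δ_j`, `Σ_{j<J} δ_j ≤ ε`. Two populations: (i) near-sheet LUMPS (within `≍ ρ log(8Z_m/(c a_k m))` of a
sheet; same physics as S2's carriers, but the zero-extension transfer is too lossy for them): Dirichlet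
cutting raises the covariant kinetic energy `λ = ⟨w, W_U w⟩/‖w‖²` of a real mode (`KineticEdge`'s
identity), so a cut lump crosses LATER than on the torus, and its positional entropy is only the boundary
layer `8 s_j³ ρ_* log(1/a_k)` (`≪ s_j⁴` at the top scales); (ii) WALL STATES (Kaplan 1992 / Shamir 1993):
by the universal face commutator `[W_c, N_c] = ½Σ_μ Γ_μ(E^μ_first − E^μ_last) + Σ_{μ≠ν} Γ_ν[W^U_μ, D^U_ν]_c`
and `‖(W_c−λ)w‖² + ‖N_c w‖² = −⟨w, [W_c,N_c] w⟩` a real mode not powered by interior curvature is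
γ_μ-POLARISED on a face layer, i.e. a domain-wall state, which exists only where the collar behind the face
is SUPERCRITICAL at `μ'`; above the pinned line the bulk is in the trivial phase (free analogue: the
Dirichlet bag at bare `μ' > 0` never crosses — landed positivity domain), so a wall state needs a COLD
collar: a Compton-size shallow one (Gaussian cost `≍ e^{-c/(h²g⁴)}`; shallow relativistic wells do not
bind below the Compton scale) or a deep `s_free`-size one (`e^{-cβ² log β}`), both `≪ a_k⁴`. Kinematics:
cells of side `< π(2/|μ'|)^{1/2}` never cross (`KineticEdge`), the one-site child only at `μ' = -4` (landed
`wilsonCell_two_det_eq_zero_iff`, excluded by the pin). Why it might fail: Disproof §5's thin place read at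
the sheets — NON-smooth, non-topological carriers of intermediate size `s_free … ρ_*` hybridising with a
face (a γ_μ-polarised layer fed by ROUGH interior plaquette commutators, `O(g₀) ≫ |μ'|` before dressing:
triage r1-2 sharpen 3), whose rarity is not a numerical-range fact; or near-sheet lumps crossing EARLIER
when cut (no variational principle for non-normal cells: the face-coupling law of motion
`λ̇_κ = ⟨w_κ, Γ₅ F w_κ⟩/χ_κ` carries a SIGN that is unproved — the card's T3). Empirical support: DD-HMC /
Schwarz-preconditioned solvers invert Dirichlet blocks of side 4–8 at light valence masses on every
configuration (Luscher2003SchwarzDD), thick-slice Schur factors behave smoothly (CeGiustiSchaefer2017).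
Size: open (smaller than S2 in entropy, new in mechanism). Leans on: `wilsonCell`, `wilsonBox`,
`halfSides`, route support `KineticEdge`, the card's `FaceCommutatorFree` / half-space wall modes
(provable supports, Sketch-ideator3.lean), Kaplan1992 (hep-lat/9206013), Shamir1993 (hep-lat/9303005),
GoltermanJansenKaplan1993 (hep-lat/9209003), Luscher2003SchwarzDD, CeGiustiSchaefer2017 (arXiv:1609.02419). -/
theorem stub_sheetAttachedRarity :
    ∀ Nf : ℕ, (Nf = 2 ∨ Nf = 3) → ∀ reg : QCDRegularisation Nf, reg.HasMassScaling →
      (reg.scheme 0 0 0).HasAsymptoticScaling → ∀ M₀ : ℝ, 0 ≤ M₀ →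
      (∀ m : Fin Nf → ℝ, (∀ f, M₀ < m f) → ∃ R : ℝ, 0 < R ∧
        (∀ M : ℝ, M₀ < M → ∀ᶠ k : ℕ in Filter.atTop, ∀ S : ℕ, R ≤ reg.a k * (2 * S + 1) →
          (1 / 4 : ℝ) ≤
            (∫ U, (if (fermionDet (wilsonDirac (fundamentalRep (Fin 3)) U
                  (reg.mcrit k - reg.a k * M / reg.Zm k) 1)).re < 0 then (1 : ℝ) else 0) *
                (∏ f, ‖fermionDet (wilsonDirac (fundamentalRep (Fin 3)) U
                  (reg.mcrit k + reg.a k * m f / reg.Zm k) 1)‖) ∂(wilsonMeasureFamily (reg.β k) S)) /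
            (∫ U, (∏ f, ‖fermionDet (wilsonDirac (fundamentalRep (Fin 3)) U
                  (reg.mcrit k + reg.a k * m f / reg.Zm k) 1)‖) ∂(wilsonMeasureFamily (reg.β k) S))) ∧
        (∀ M : ℝ, M₀ < M → ∀ᶠ k : ℕ in Filter.atTop, ∀ S : ℕ, R ≤ reg.a k * (2 * S + 1) →
          reg.a k * (2 * S + 1) ≤ 2 * R →
            (∫ U, (if (fermionDet (wilsonDirac (fundamentalRep (Fin 3)) U
                  (reg.mcrit k + reg.a k * M / reg.Zm k) 1)).re < 0 then (1 : ℝ) else 0) *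
                (∏ f, ‖fermionDet (wilsonDirac (fundamentalRep (Fin 3)) U
                  (reg.mcrit k + reg.a k * m f / reg.Zm k) 1)‖) ∂(wilsonMeasureFamily (reg.β k) S)) /
            (∫ U, (∏ f, ‖fermionDet (wilsonDirac (fundamentalRep (Fin 3)) U
                  (reg.mcrit k + reg.a k * m f / reg.Zm k) 1)‖) ∂(wilsonMeasureFamily (reg.β k) S))
              ≤ (1 / 8 : ℝ))) →
      ∀ c : ℝ, 0 < c → ∀ b₀ : ℕ, 2 ≤ b₀ → ∀ ℓ : ℝ, 0 < ℓ → ∀ m : Fin Nf → ℝ, (∀ f, M₀ < m f) →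
        ∀ R : ℝ, 0 < R → ∀ ε : ℝ, 0 < ε → ∀ᶠ k : ℕ in Filter.atTop, ∀ S : ℕ,
          R ≤ reg.a k * (2 * S + 1) →
          ∃ δ : ℕ → ℝ, (∀ j, 0 ≤ δ j) ∧
            ∑ j ∈ Finset.range (Nat.log 2 (⌊ℓ / reg.a k⌋₊ / b₀) + 1), δ j ≤ ε ∧
            ∀ j < Nat.log 2 (⌊ℓ / reg.a k⌋₊ / b₀) + 1,
              ∀ (x : TorusSite 4 (2 * S + 1)) (t : Fin 4 → ℕ),
                (∀ i, t i < b₀ * 2 ^ (j + 2) ∧ t i ≤ 2 * S + 1 ∧ (t i : ℝ) * reg.a k ≤ ℓ) →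
                ∃ g : GaugeConfig 4 (2 * S + 1) SU3 → ℝ, (∀ U, 0 ≤ g U) ∧
                  (∀ U, (∃ f : Fin Nf, ∃ μ' : ℝ, reg.mcrit k + reg.a k * m f / reg.Zm k ≤ μ' ∧
                      ∃ w : {p // wilsonBox x t p} → ℂ, w ≠ 0 ∧ wilsonCell U μ' x t *ᵥ w = 0 ∧
                        (c * (reg.a k * m f / reg.Zm k) / 8) ^ 2 * ∑ q, ‖w q‖ ^ 2 <
                          ∑ q : {p // wilsonBox x t p},
                            (if (∃ i, (q.1.1 i - x i).val = 1 ∨ (q.1.1 i - x i).val + 1 = t i)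
                              then ‖w q‖ ^ 2 else 0)) → 1 ≤ g U) ∧
                  MeasureTheory.Integrable (fun U => g U *
                    (∏ f, ‖fermionDet (wilsonDirac (fundamentalRep (Fin 3)) U
                      (reg.mcrit k + reg.a k * m f / reg.Zm k) 1)‖)) (wilsonMeasureFamily (reg.β k) S) ∧
                  (∫ U, g U * (∏ f, ‖fermionDet (wilsonDirac (fundamentalRep (Fin 3)) U
                      (reg.mcrit k + reg.a k * m f / reg.Zm k) 1)‖) ∂(wilsonMeasureFamily (reg.β k) S)) /
                    (∫ U, (∏ f, ‖fermionDet (wilsonDirac (fundamentalRep (Fin 3)) U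
                      (reg.mcrit k + reg.a k * m f / reg.Zm k) 1)‖) ∂(wilsonMeasureFamily (reg.β k) S))
                    ≤ δ j := by
  sorry

/-- **S4 — the two-sided parity pin is realised (open; clauses (b) ∧ (b″) of the crux with its `∃ reg`,
untouched by this idea — panel note P1's NAMED pin, RobustYangMills class; recommended for filing as a
shared route item reusable by `SpectralDefectExtinction`'s TIGHT clause; NOT this line's lever).** For
`N_f ∈ {2,3}` there are an admissible `reg` (HasMassScaling, HasAsymptoticScaling) and `M₀ ≥ 0` such that
for every `m > M₀` one `R > 0` serves (b) — a distance `M > M₀` BELOW the line `P(Re det D_W < 0) ≥ ¼`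
on all odd tori of physical side `≥ R` — and (b″) — a distance `M > M₀` ABOVE it `P(Re det D_W < 0) ≤ ⅛`
on tori of side in `[R, 2R]`, eventually in `k` (P = the phase-quenched probability, `|det|`-reweighted
Wilson measure at `β_k`). Content: (b) = P(`wilsonSpectralIndex` odd) `≥ ¼` (tree
`WilsonDeterminantSign_holds`) = topological parity surviving the continuum limit on `R`-tori
(`χ_t R⁴ ≳ 0.35`) with index modes crossing within `O(a²) ≪ a_k M/Z_m` of the line; (b″) = the
Mohler–Schaefer observable `⟨n_neg⟩ → 0` at FIXED physical volume made a clause; `m_crit(k)` := the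
parity-jump line (below every doubler line `-2,-4,-6` the real-mode count jumps by an EVEN multiple of
`|Q|`, at `-8` with the wrong orientation, so only the physical line qualifies). It is the only
content-bearing clause by `trivial_without_lowerPin`, and it is what makes S2/S3 non-vacuous and honest.
Why it might fail: `χ_t > 0` in the continuum limit is Yang–Mills-hard (dimensional transmutation; the
fluctuation determinant around an instanton inside a rough exterior); the crossover band of the parity
observable could be wider than `2a_kM₀/Z_m` for every `M₀` if index modes of thin abelian flux sheets cross
over a band `≫ a_k/Z_m`. Size: open (route tier; shared fate with the sibling route's TIGHT/EXTINCT and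
this route's foreseen `IndexModesCrossAtTheLine`). Leans on: `WilsonDeterminantSign_holds`,
`wilsonSpectralIndex`, `fermionDet_wilsonDirac_re_pos`, `QCDRegularisation.canonicalAF`; crux idea
local-tunnelling-telescoping's `PinIsOddIndex` / `ParityTelescoping` (provable glue); MohlerSchaefer2020,
EdwardsHellerNarayanan1998, Luscher1982Topology. -/
theorem stub_twoSidedParityPin :
    ∀ Nf : ℕ, (Nf = 2 ∨ Nf = 3) → ∃ reg : QCDRegularisation Nf, reg.HasMassScaling ∧
      (reg.scheme 0 0 0).HasAsymptoticScaling ∧ ∃ M₀ : ℝ, 0 ≤ M₀ ∧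
      ∀ m : Fin Nf → ℝ, (∀ f, M₀ < m f) → ∃ R : ℝ, 0 < R ∧
        (∀ M : ℝ, M₀ < M → ∀ᶠ k : ℕ in Filter.atTop, ∀ S : ℕ, R ≤ reg.a k * (2 * S + 1) →
          (1 / 4 : ℝ) ≤
            (∫ U, (if (fermionDet (wilsonDirac (fundamentalRep (Fin 3)) U
                  (reg.mcrit k - reg.a k * M / reg.Zm k) 1)).re < 0 then (1 : ℝ) else 0) *
                (∏ f, ‖fermionDet (wilsonDirac (fundamentalRep (Fin 3)) U
                  (reg.mcrit k + reg.a k * m f / reg.Zm k) 1)‖) ∂(wilsonMeasureFamily (reg.β k) S)) /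
            (∫ U, (∏ f, ‖fermionDet (wilsonDirac (fundamentalRep (Fin 3)) U
                  (reg.mcrit k + reg.a k * m f / reg.Zm k) 1)‖) ∂(wilsonMeasureFamily (reg.β k) S))) ∧
        (∀ M : ℝ, M₀ < M → ∀ᶠ k : ℕ in Filter.atTop, ∀ S : ℕ, R ≤ reg.a k * (2 * S + 1) →
          reg.a k * (2 * S + 1) ≤ 2 * R →
            (∫ U, (if (fermionDet (wilsonDirac (fundamentalRep (Fin 3)) U
                  (reg.mcrit k + reg.a k * M / reg.Zm k) 1)).re < 0 then (1 : ℝ) else 0) *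
                (∏ f, ‖fermionDet (wilsonDirac (fundamentalRep (Fin 3)) U
                  (reg.mcrit k + reg.a k * m f / reg.Zm k) 1)‖) ∂(wilsonMeasureFamily (reg.β k) S)) /
            (∫ U, (∏ f, ‖fermionDet (wilsonDirac (fundamentalRep (Fin 3)) U
                  (reg.mcrit k + reg.a k * m f / reg.Zm k) 1)‖) ∂(wilsonMeasureFamily (reg.β k) S))
              ≤ (1 / 8 : ℝ)) := by
  sorry

/-! ## §2 Composition (sorry-free; cites the four stubs by name) -/

open scoped Classical in
/-- **Outer union bound.** If every event `A i` of a finite family is majorised at level `δ i` under the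
weight `wt ≥ 0` (a non-negative `g i ≥ 1_{A i}` with `g i · wt` integrable and `∫ g i wt / ∫ wt ≤ δ i`),
then every event `E` covered by the family has phase-quenched (outer) probability `≤ Σ δ i` — no
measurability of `E` is needed (monotonicity of the Bochner integral against an integrable majorant; a
non-integrable numerator is the junk `0`; `x / 0 = 0`). -/
theorem outer_union_bound {Ω : Type*} [MeasurableSpace Ω] {μW : Measure Ω} {wt : Ω → ℝ}
    (hwt : ∀ U, 0 ≤ wt U) {ι : Type*} [Fintype ι] {A : ι → Ω → Prop} {δ : ι → ℝ}
    (hA : ∀ i, ∃ g : Ω → ℝ, (∀ U, 0 ≤ g U) ∧ (∀ U, A i U → 1 ≤ g U) ∧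
      Integrable (fun U => g U * wt U) μW ∧ (∫ U, g U * wt U ∂μW) / (∫ U, wt U ∂μW) ≤ δ i)
    {E : Ω → Prop} (hE : ∀ U, E U → ∃ i, A i U) :
    (∫ U, (if E U then (1 : ℝ) else 0) * wt U ∂μW) / (∫ U, wt U ∂μW) ≤ ∑ i, δ i := by
  choose g hg0 hg1 hgi hgb using hA
  have hZ : 0 ≤ ∫ U, wt U ∂μW := integral_nonneg hwt
  have hGi : Integrable (fun U => ∑ i, g i U * wt U) μW := integrable_finsetSum _ fun i _ => hgi i
  have hmono : ∫ U, (if E U then (1 : ℝ) else 0) * wt U ∂μW ≤ ∫ U, ∑ i, g i U * wt U ∂μW := by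
    refine integral_mono_of_nonneg (Eventually.of_forall fun U => ?_) hGi
      (Eventually.of_forall fun U => ?_)
    · show (0 : ℝ) ≤ (if E U then (1 : ℝ) else 0) * wt U
      have h01 : (0 : ℝ) ≤ (if E U then (1 : ℝ) else 0) := by split_ifs <;> norm_num
      exact mul_nonneg h01 (hwt U)
    · show (if E U then (1 : ℝ) else 0) * wt U ≤ ∑ i, g i U * wt U
      rw [← Finset.sum_mul]
      refine mul_le_mul_of_nonneg_right ?_ (hwt U)
      split_ifs with hU
      · obtain ⟨i, hi⟩ := hE U hU
        exact le_trans (hg1 i U hi) (Finset.single_le_sum (fun j _ => hg0 j U) (Finset.mem_univ i))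
      · exact Finset.sum_nonneg fun j _ => hg0 j U
  calc (∫ U, (if E U then (1 : ℝ) else 0) * wt U ∂μW) / (∫ U, wt U ∂μW)
      ≤ (∫ U, ∑ i, g i U * wt U ∂μW) / (∫ U, wt U ∂μW) := div_le_div_of_nonneg_right hmono hZ
    _ = ∑ i, (∫ U, g i U * wt U ∂μW) / (∫ U, wt U ∂μW) := by
        rw [integral_finsetSum _ (fun i _ => hgi i), Finset.sum_div]
    _ ≤ ∑ i, δ i := Finset.sum_le_sum fun i _ => hgb i

open scoped Classical in
/-- **The crux, by name**, from the four registered stubs (their `sorry`s are the only gaps): `reg, M₀` and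
the pin from S4; `c` from S2; `b₀ := 2`, `ℓ := 1`; (b), (b″) verbatim; (a′) by the face dichotomy, S1, S2,
S3 and `outer_union_bound` over the 17 boxes × 2 populations. -/
theorem EarlyCrosserLaw_of : EarlyCrosserLaw := by
  intro Nf hNf
  obtain ⟨reg, hms, has, M₀, hM₀, hpin⟩ := stub_twoSidedParityPin Nf hNf
  obtain ⟨c, hc, hext⟩ := stub_torusLocalExtinction Nf hNf reg hms has M₀ hM₀ hpin
  have hsheet := stub_sheetAttachedRarity Nf hNf reg hms has M₀ hM₀ hpin c hc
  refine ⟨reg, hms, has, M₀, hM₀, 2, le_rfl, 1, one_pos, fun m hm => ?_⟩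
  obtain ⟨R, hR, hlow, hup⟩ := hpin m hm
  refine ⟨R, hR, ?_, hlow, hup⟩
  -- clause (a′)
  intro ε hε
  have hε' : 0 < ε / 34 := by positivity
  filter_upwards [hext 2 le_rfl 1 one_pos m hm R hR (ε / 34) hε',
    hsheet 2 le_rfl 1 one_pos m hm R hR (ε / 34) hε'] with k hk₂ hk₃
  intro S hS
  obtain ⟨δ₂, hδ₂0, hδ₂s, H₂⟩ := hk₂ S hS
  obtain ⟨δ₃, hδ₃0, hδ₃s, H₃⟩ := hk₃ S hS
  dsimp only
  refine ⟨fun j => 17 * (δ₂ j + δ₃ j), fun j => ?_, ?_, ?_⟩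
  · have := hδ₂0 j; have := hδ₃0 j; positivity
  · rw [← Finset.mul_sum, Finset.sum_add_distrib]; linarith
  intro j hj s hs E hE
  -- the 17 boxes: `none` = the parent `(0, s)`, `some c'` = the child `c'`
  let xo : Option (Fin 4 → Bool) → TorusSite 4 (2 * S + 1) := fun o => o.elim 0 fun c' => halfCorner s c'
  let ts : Option (Fin 4 → Bool) → (Fin 4 → ℕ) := fun o => o.elim s fun c' => halfSides s c'
  have hto : ∀ o i, ts o i ≤ s i := by
    rintro (_ | c') i
    · exact le_rfl
    · exact halfSides_le s c' i
  have hbox : ∀ o i, ts o i < 2 * 2 ^ (j + 2) ∧ ts o i ≤ 2 * S + 1 ∧ (ts o i : ℝ) * reg.a k ≤ 1 := by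
    intro o i
    obtain ⟨-, h2, h3, h4⟩ := hs i
    refine ⟨lt_of_le_of_lt (hto o i) h2, (hto o i).trans h3, le_trans ?_ h4⟩
    exact mul_le_mul_of_nonneg_right (Nat.cast_le.mpr (hto o i)) (reg.a_pos k).le
  -- the weight and the two event families
  have hwt : ∀ U : GaugeConfig 4 (2 * S + 1) SU3,
      0 ≤ ∏ f, ‖fermionDet (wilsonDirac (fundamentalRep (Fin 3)) U
        (reg.mcrit k + reg.a k * m f / reg.Zm k) 1)‖ :=
    fun U => Finset.prod_nonneg fun f _ => norm_nonneg _
  let A₂ : Option (Fin 4 → Bool) → GaugeConfig 4 (2 * S + 1) SU3 → Prop := fun o U =>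
    ∃ f : Fin Nf, ∃ μ' : ℝ, reg.mcrit k + reg.a k * m f / reg.Zm k ≤ μ' ∧
      ∃ v : {p // wilsonBox (xo o) (ts o) p} → ℂ, v ≠ 0 ∧
        ∑ p, ‖(wilsonDirac (fundamentalRep (Fin 3)) U μ' 1 *ᵥ
            fun q => if h : wilsonBox (xo o) (ts o) q then v ⟨q, h⟩ else 0) p‖ ^ 2 ≤
          (c * (reg.a k * m f / reg.Zm k)) ^ 2 * ∑ q, ‖v q‖ ^ 2
  let A₃ : Option (Fin 4 → Bool) → GaugeConfig 4 (2 * S + 1) SU3 → Prop := fun o U =>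
    ∃ f : Fin Nf, ∃ μ' : ℝ, reg.mcrit k + reg.a k * m f / reg.Zm k ≤ μ' ∧
      ∃ w : {p // wilsonBox (xo o) (ts o) p} → ℂ, w ≠ 0 ∧
        wilsonCell U μ' (xo o) (ts o) *ᵥ w = 0 ∧
        (c * (reg.a k * m f / reg.Zm k) / 8) ^ 2 * ∑ q, ‖w q‖ ^ 2 <
          ∑ q : {p // wilsonBox (xo o) (ts o) p},
            (if (∃ i, (q.1.1 i - xo o i).val = 1 ∨ (q.1.1 i - xo o i).val + 1 = ts o i)
              then ‖w q‖ ^ 2 else 0)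
  -- every crossing of a parent/child cell lands in one of the two families (face dichotomy + S1)
  have key : ∀ (o : Option (Fin 4 → Bool)) (U : GaugeConfig 4 (2 * S + 1) SU3) (f : Fin Nf) (μ' : ℝ),
      reg.mcrit k + reg.a k * m f / reg.Zm k ≤ μ' → (wilsonCell U μ' (xo o) (ts o)).det = 0 →
      A₂ o U ∨ A₃ o U := by
    intro o U f μ' hμ' hdet
    obtain ⟨w, hw0, hw⟩ := Matrix.exists_mulVec_eq_zero_iff.mpr hdet
    by_cases hface :
        (∑ q : {p // wilsonBox (xo o) (ts o) p},
            (if (∃ i, (q.1.1 i - xo o i).val = 1 ∨ (q.1.1 i - xo o i).val + 1 = ts o i)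
              then ‖w q‖ ^ 2 else 0)) ≤
          (c * (reg.a k * m f / reg.Zm k) / 8) ^ 2 * ∑ q, ‖w q‖ ^ 2
    · left
      refine ⟨f, μ', hμ', w, hw0, ?_⟩
      have hleak := stub_zeroExtensionQuasimode (2 * S + 1) U μ' (xo o) (ts o) w
        (fun i => (hbox o i).2.1) hw
      calc ∑ p, ‖(wilsonDirac (fundamentalRep (Fin 3)) U μ' 1 *ᵥ
              fun q => if h : wilsonBox (xo o) (ts o) q then w ⟨q, h⟩ else 0) p‖ ^ 2
          ≤ 64 * ∑ q : {p // wilsonBox (xo o) (ts o) p},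
              (if (∃ i, (q.1.1 i - xo o i).val = 1 ∨ (q.1.1 i - xo o i).val + 1 = ts o i)
                then ‖w q‖ ^ 2 else 0) := hleak
        _ ≤ 64 * ((c * (reg.a k * m f / reg.Zm k) / 8) ^ 2 * ∑ q, ‖w q‖ ^ 2) :=
            mul_le_mul_of_nonneg_left hface (by norm_num)
        _ = (c * (reg.a k * m f / reg.Zm k)) ^ 2 * ∑ q, ‖w q‖ ^ 2 := by ring
    · right
      exact ⟨f, μ', hμ', w, hw0, hw, lt_of_not_ge hface⟩
  have hA : ∀ i : Option (Fin 4 → Bool) ⊕ Option (Fin 4 → Bool),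
      ∃ g : GaugeConfig 4 (2 * S + 1) SU3 → ℝ, (∀ U, 0 ≤ g U) ∧
        (∀ U, Sum.elim A₂ A₃ i U → 1 ≤ g U) ∧
        Integrable (fun U => g U * ∏ f, ‖fermionDet (wilsonDirac (fundamentalRep (Fin 3)) U
          (reg.mcrit k + reg.a k * m f / reg.Zm k) 1)‖) (wilsonMeasureFamily (reg.β k) S) ∧
        (∫ U, g U * ∏ f, ‖fermionDet (wilsonDirac (fundamentalRep (Fin 3)) U
            (reg.mcrit k + reg.a k * m f / reg.Zm k) 1)‖ ∂(wilsonMeasureFamily (reg.β k) S)) /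
          (∫ U, ∏ f, ‖fermionDet (wilsonDirac (fundamentalRep (Fin 3)) U
            (reg.mcrit k + reg.a k * m f / reg.Zm k) 1)‖ ∂(wilsonMeasureFamily (reg.β k) S)) ≤
          Sum.elim (fun _ => δ₂ j) (fun _ => δ₃ j) i := by
    rintro (o | o)
    · exact H₂ j hj (xo o) (ts o) (hbox o)
    · exact H₃ j hj (xo o) (ts o) (hbox o)
  have hE' : ∀ U, E U → ∃ i : Option (Fin 4 → Bool) ⊕ Option (Fin 4 → Bool), Sum.elim A₂ A₃ i U := by
    intro U hU
    obtain ⟨f, μ', hμ', hsing⟩ := hE U hU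
    rcases hsing with h0 | ⟨c', hc'⟩
    · rcases key none U f μ' hμ' h0 with h | h
      · exact ⟨Sum.inl none, h⟩
      · exact ⟨Sum.inr none, h⟩
    · rcases key (some c') U f μ' hμ' hc' with h | h
      · exact ⟨Sum.inl (some c'), h⟩
      · exact ⟨Sum.inr (some c'), h⟩
  have hδsum : ∑ i : Option (Fin 4 → Bool) ⊕ Option (Fin 4 → Bool),
      Sum.elim (fun _ => δ₂ j) (fun _ => δ₃ j) i = 17 * (δ₂ j + δ₃ j) := by
    rw [Fintype.sum_sum_type]
    simp only [Sum.elim_inl, Sum.elim_inr, Finset.sum_const, Finset.card_univ, Fintype.card_option,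
      Fintype.card_fun, Fintype.card_bool, Fintype.card_fin, nsmul_eq_mul]
    norm_num
    ring
  calc _ ≤ ∑ i : Option (Fin 4 → Bool) ⊕ Option (Fin 4 → Bool),
        Sum.elim (fun _ => δ₂ j) (fun _ => δ₃ j) i := outer_union_bound hwt hA hE'
    _ = 17 * (δ₂ j + δ₃ j) := hδsum

end Summit.QuantumFields.QCD.Cruxes.EarlyCrosserLaw.CellsInheritTorusExtinction

end
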